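import Summits.ValiantsHypothesis.ValiantsHypothesis.Theorems.DivisionGapDefs

/-!
# Crux `DivisionGap.PerDivisionHard` (stmt-ValiantsHypothesis-5065), line `pair-descent-jss-endpoint` —
stub `stub_linearUniqueTop`: an affine linear form is uniquely topped by an injective positive character

Under a weight `w : σ → ℕ` that is INJECTIVE with POSITIVE values, a polynomial `l` over `ℝ≥0` of
total degree `≤ 1` (an affine linear form `c + Σ_e c_e x_e`) has a top-`w` component
(`topComponent w l`, the terms of `l` of maximal `w`-weight) with at most one monomial: the
monomials of `l` are `1` (weight `0`) and the `x_e` (weights `w e ≥ 1`, pairwise distinct), so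
distinct monomials of `l` have distinct weights, while all monomials of `topComponent w l` have the
same weight `weightedTotalDegree w l` (`coeff_topComponent`).

`stub_linearUniqueTop` is the instance `σ = Fin n × Fin n`, `w (i, j) = i·n + 1 + j`, which is
injective (`i = (j + i·n) / n` and `j = (j + i·n) % n` as `j < n`) and positive. [folklore]
-/

noncomputable section

-- `Summit.ValiantsHypothesis.ValiantsHypothesis.…` is the tree's mandated single-conjunct layout
-- (Sub = Summit), so the duplicated namespace component is intended.
set_option linter.dupNamespace false

namespace Summit.ValiantsHypothesis.ValiantsHypothesis.Theorems.DivisionGapPerDivisionHard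

open MvPolynomial
open Summit.ValiantsHypothesis.ValiantsHypothesis.Theorems.ZeroOneTransfer.Negative
open scoped NNReal

/-- A monomial of a polynomial of total degree `≤ 1` is `1` or a single variable. [folklore] -/
theorem eq_zero_or_eq_single_of_totalDegree_le_one {σ R : Type*} [CommSemiring R]
    {l : MvPolynomial σ R} (hl : l.totalDegree ≤ 1) {d : σ →₀ ℕ} (hd : d ∈ l.support) :
    d = 0 ∨ ∃ s, d = Finsupp.single s 1 := by
  have hdeg : (d.sum fun _ e => e) ≤ 1 := (le_totalDegree hd).trans hl
  rcases Nat.le_one_iff_eq_zero_or_eq_one.mp hdeg with h0 | h1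
  · exact Or.inl ((Finsupp.degree_eq_zero_iff d).mp h0)
  · exact Or.inr ((Finsupp.sum_eq_one_iff d).mp h1)

/-- Under an injective weight with positive values, the top component of a polynomial over `ℝ≥0`
of total degree `≤ 1` has at most one monomial: its monomials are monomials of `l`, i.e. `1`
(weight `0`) or variables `x_s` (pairwise distinct positive weights `w s`), and they all have the
same weight `weightedTotalDegree w l`. [folklore] -/
theorem card_support_topComponent_le_one_of_totalDegree_le_one {σ : Type*} (w : σ → ℕ)
    (hinj : Function.Injective w) (hpos : ∀ s, 0 < w s) {l : MvPolynomial σ ℝ≥0}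
    (hl : l.totalDegree ≤ 1) : (topComponent w l).support.card ≤ 1 := by
  -- every monomial of the top component is a monomial of `l` of weight `weightedTotalDegree w l`
  have key : ∀ d ∈ (topComponent w l).support,
      Finsupp.weight w d = weightedTotalDegree w l ∧ d ∈ l.support := by
    intro d hd
    rw [mem_support_iff, coeff_topComponent] at hd
    split_ifs at hd with h
    · exact ⟨h, mem_support_iff.mpr hd⟩
    · exact absurd rfl hd
  -- the weights of the admissible monomials
  have hw0 : Finsupp.weight w (0 : σ →₀ ℕ) = 0 := map_zero _
  have hw1 : ∀ s, Finsupp.weight w (Finsupp.single s 1) = w s := fun s => by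
    rw [Finsupp.weight_single, one_smul]
  refine Finset.card_le_one.mpr fun d₁ h₁ d₂ h₂ => ?_
  obtain ⟨hd₁, hs₁⟩ := key d₁ h₁
  obtain ⟨hd₂, hs₂⟩ := key d₂ h₂
  have heq : Finsupp.weight w d₁ = Finsupp.weight w d₂ := hd₁.trans hd₂.symm
  rcases eq_zero_or_eq_single_of_totalDegree_le_one hl hs₁ with rfl | ⟨s₁, rfl⟩ <;>
    rcases eq_zero_or_eq_single_of_totalDegree_le_one hl hs₂ with rfl | ⟨s₂, rfl⟩
  · rfl
  · rw [hw0, hw1] at heq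
    exact absurd heq (hpos s₂).ne
  · rw [hw0, hw1] at heq
    exact absurd heq (hpos s₁).ne'
  · rw [hw1, hw1] at heq
    rw [hinj heq]

/-- The character `(i, j) ↦ i·n + 1 + j` is injective on `Fin n × Fin n`: `i = (j + i·n) / n` and
`j = (j + i·n) % n` since `j < n`. [folklore] -/
theorem rowMajorSucc_injective (n : ℕ) :
    Function.Injective (fun e : Fin n × Fin n => ((e.1 : ℕ) * n + 1) + (e.2 : ℕ)) := by
  rintro ⟨i, j⟩ ⟨i', j'⟩ h
  have hn : 0 < n := i.pos
  have h' : (j : ℕ) + i * n = j' + i' * n := by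
    simp only at h
    omega
  have hi : (i : ℕ) = i' := by
    have h1 := congrArg (· / n) h'
    rwa [Nat.add_mul_div_right _ _ hn, Nat.add_mul_div_right _ _ hn, Nat.div_eq_of_lt j.2,
      Nat.div_eq_of_lt j'.2, Nat.zero_add, Nat.zero_add] at h1
  have hj : (j : ℕ) = j' := by
    have h1 := congrArg (· % n) h'
    rwa [Nat.add_mul_mod_self_right, Nat.add_mul_mod_self_right, Nat.mod_eq_of_lt j.2,
      Nat.mod_eq_of_lt j'.2] at h1
  exact Prod.ext (Fin.ext hi) (Fin.ext hj)

/-- **`stub_linearUniqueTop`.**  Under the injective positive character `w (i, j) = i·n + 1 + j`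
an affine linear form (`totalDegree ≤ 1`: monomials `1` of weight `0` and `x_e` of the pairwise
distinct positive weights `w e`) is topped by at most one monomial. [folklore] -/
theorem stub_linearUniqueTop :
    ∀ (n : ℕ) (l : MvPolynomial (Fin n × Fin n) ℝ≥0), l.totalDegree ≤ 1 →
      (topComponent (fun e : Fin n × Fin n => ((e.1 : ℕ) * n + 1) + (e.2 : ℕ)) l).support.card ≤ 1 :=
  fun n _ hl => card_support_topComponent_le_one_of_totalDegree_le_one _ (rowMajorSucc_injective n)
    (fun e => by positivity) hl

end Summit.ValiantsHypothesis.ValiantsHypothesis.Theorems.DivisionGapPerDivisionHard
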